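import Mathlib
import HarnessLib
import Literature.Probability.LatticeModels.IsingLimitLaw
import Summits.RiemannHypothesis.RiemannHypothesis.Theorems.LeeYangLeeyangPolyaKernelIsingLimitDefs

/-!
# The cone profile of the witness chains (helpers for stub `stub_moments`, crux stmt-RiemannHypothesis-0453)

Line `telegraph-bessel-chain` of the crux `LeeYang.LeeyangPolyaKernelIsingLimit`, lead prover.
Arithmetic of the witness chains (`η_k = mesh k`, `N_k = nBonds k`, `T_k = horizon k`,
`t_m = siteTime k m`), and the instantiation of the cone invariant of the real-`h` transfer recursion
(stub `stub_cone`, taken here as a hypothesis `hcone`) with the profile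
`κ_m = min(1, max(2h e^{−t_m}/a, 4hη))`: it is admissible because
`1 − c_m ≥ 1 − e^{−u} ≥ u/(1+u)` with `u = 2ηa e^{t_{m+1}}` (`c_m = bondTanh a k m`, `r ≥ v`), and
`min(1,x) ≤ √x` plus the geometric sum `Σ_{m<N} e^{−t_m/2} ≤ 2/η` bound the resulting exponent:
`(N+1)(hη)²/2 + hη Σ κ_m ≤ 2√2 h√h/√a + 5η_k(T_k+1) h²` (`cone_chain`, `exponent_le`).
Elementary real analysis; [folklore].
-/

noncomputable section

namespace Summit.RiemannHypothesis.RiemannHypothesis.Theorems.LeeYangTelegraph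

open MeasureTheory Filter Topology Complex
open Literature.Probability.LatticeModels Literature.Analysis.Complex.Polya1926

/-! ### Arithmetic of the witness chains -/

/-- `(k : ℝ) + 2 ≥ 2`. [folklore] -/
theorem two_le_cast' (k : ℕ) : (2 : ℝ) ≤ (k : ℝ) + 2 := by
  have : (0 : ℝ) ≤ k := Nat.cast_nonneg k
  linarith

/-- `N_k = (k+2)^5` as a real number. [folklore] -/
theorem nBonds_cast' (k : ℕ) : (nBonds k : ℝ) = ((k : ℝ) + 2) ^ 5 := by
  unfold nBonds; push_cast; ring

/-- `N_k > 0`. [folklore] -/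
theorem nBonds_pos' (k : ℕ) : (0 : ℝ) < nBonds k := by
  rw [nBonds_cast']; have := two_le_cast' k; positivity

/-- `T_k > 0`. [folklore] -/
theorem horizon_pos' (k : ℕ) : 0 < horizon k :=
  Real.log_pos (by have := two_le_cast' k; linarith)

/-- `T_k ≤ k + 2`. [folklore] -/
theorem horizon_le' (k : ℕ) : horizon k ≤ (k : ℝ) + 2 := by
  have := two_le_cast' k
  have h := Real.log_le_sub_one_of_pos (show (0 : ℝ) < (k : ℝ) + 2 by linarith)
  unfold horizon; linarith

/-- `0 < η_k = T_k/N_k` (numerator and denominator positive). [folklore] -/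
theorem mesh_pos' (k : ℕ) : 0 < horizon k ∧ 0 < (nBonds k : ℝ) ∧ 0 < mesh k :=
  ⟨horizon_pos' k, nBonds_pos' k, div_pos (horizon_pos' k) (nBonds_pos' k)⟩

/-- `N_k η_k = T_k`. [folklore] -/
theorem nBonds_mul_mesh' (k : ℕ) : (nBonds k : ℝ) * mesh k = horizon k := by
  unfold mesh; field_simp [(nBonds_pos' k).ne']

/-- `η_k (T_k + 1) ≤ 2/(k+2)` (so it tends to `0`), and in particular `η_k ≤ 1`. [folklore] -/
theorem mesh_mul_le' (k : ℕ) : mesh k * (horizon k + 1) ≤ 2 / ((k : ℝ) + 2) := by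
  have h2 := two_le_cast' k
  have hT := horizon_le' k
  have hT0 := (horizon_pos' k).le
  unfold mesh
  rw [nBonds_cast', div_mul_eq_mul_div, div_le_div_iff₀ (by positivity) (by positivity)]
  have h3 : horizon k * (horizon k + 1) ≤ ((k : ℝ) + 2) * ((k : ℝ) + 3) := by nlinarith
  have h5 : (k : ℝ) + 3 ≤ 2 * ((k : ℝ) + 2) ^ 3 := by
    have h4' : (4 : ℝ) ≤ ((k : ℝ) + 2) ^ 2 := by nlinarith
    nlinarith
  have h4 : ((k : ℝ) + 2) * ((k : ℝ) + 3) * ((k : ℝ) + 2) ≤ 2 * ((k : ℝ) + 2) ^ 5 := by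
    calc ((k : ℝ) + 2) * ((k : ℝ) + 3) * ((k : ℝ) + 2) = ((k : ℝ) + 2) ^ 2 * ((k : ℝ) + 3) := by ring
      _ ≤ ((k : ℝ) + 2) ^ 2 * (2 * ((k : ℝ) + 2) ^ 3) := by gcongr
      _ = 2 * ((k : ℝ) + 2) ^ 5 := by ring
  have h6 : horizon k * (horizon k + 1) * ((k : ℝ) + 2) ≤ ((k : ℝ) + 2) * ((k : ℝ) + 3) * ((k : ℝ) + 2) :=
    mul_le_mul_of_nonneg_right h3 (by positivity)
  linarith

/-- `η_k ≤ 1`. [folklore] -/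
theorem mesh_le_one' (k : ℕ) : mesh k ≤ 1 := by
  have h := mesh_mul_le' k
  have h2 := two_le_cast' k
  have hT0 := (horizon_pos' k).le
  have hη := ((mesh_pos' k).2.2).le
  have h3 : 2 / ((k : ℝ) + 2) ≤ 1 := by rw [div_le_one (by positivity)]; linarith
  nlinarith

/-- `t_{m+1} = t_m − η`. [folklore] -/
theorem siteTime_succ' (k m : ℕ) : siteTime k (m + 1) = siteTime k m - mesh k := by
  unfold siteTime; push_cast; ring

/-- `t_m ≥ 0` for `m ≤ N`. [folklore] -/
theorem siteTime_nonneg' (k m : ℕ) (hm : m ≤ nBonds k) : 0 ≤ siteTime k m := by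
  unfold siteTime
  refine mul_nonneg ?_ ((mesh_pos' k).2.2).le
  have : (m : ℝ) ≤ nBonds k := by exact_mod_cast hm
  linarith

/-- For `m < N`, `t_m = (N − m)·η` with a natural-number difference. [folklore] -/
theorem siteTime_eq_cast' (k m : ℕ) (hm : m ≤ nBonds k) :
    siteTime k m = ((nBonds k - m : ℕ) : ℝ) * mesh k := by
  unfold siteTime; rw [Nat.cast_sub hm]

section Bond

variable {a : ℝ}

/-- The bond parameters lie in `(0, 1)` (the rate is positive). [folklore] -/
theorem bondTanh_mem' (hr1 : ∀ t : ℝ, a * Real.exp t ≤ flipRate a t) (ha : 0 < a) (k m : ℕ) :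
    0 < bondTanh a k m ∧ bondTanh a k m < 1 := by
  refine ⟨Real.exp_pos _, ?_⟩
  unfold bondTanh
  rw [Real.exp_lt_one_iff]
  have hr : 0 < flipRate a (siteTime k (m + 1)) :=
    (mul_pos ha (Real.exp_pos _)).trans_le (hr1 _)
  have := mul_pos (mul_pos two_pos ((mesh_pos' k).2.2)) hr
  linarith

end Bond

/-! ### The cone profile of the witness chains -/

/-- `1 − e^{−u} ≥ u/(1+u)` for `u ≥ 0`. [folklore] -/
private lemma one_sub_exp_neg_ge {u : ℝ} (hu : 0 ≤ u) : u / (1 + u) ≤ 1 - Real.exp (-u) := by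
  have h1 : u + 1 ≤ Real.exp u := Real.add_one_le_exp u
  have h2 : Real.exp (-u) = (Real.exp u)⁻¹ := Real.exp_neg u
  rw [h2, div_le_iff₀ (by linarith)]
  have h3 : 0 < Real.exp u := Real.exp_pos u
  have h4 : (Real.exp u)⁻¹ * (1 + u) ≤ 1 := by
    rw [inv_mul_le_iff₀ h3]; linarith
  nlinarith

/-- The key scalar inequality behind admissibility of the profile: for `u > 0`, `x ≥ 0`,
`2x ≤ (1 − e^{−u}) · max(4x/u, 4x)`. [folklore] -/
private lemma two_mul_le_key {u x : ℝ} (hu : 0 < u) (hx : 0 ≤ x) :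
    2 * x ≤ (1 - Real.exp (-u)) * max (4 * x / u) (4 * x) := by
  have h1 := one_sub_exp_neg_ge hu.le
  have hpos : 0 ≤ 1 - Real.exp (-u) := le_trans (by positivity) h1
  rcases le_or_gt u 1 with hu1 | hu1
  · calc 2 * x ≤ u / (1 + u) * (4 * x / u) := by
          rw [div_mul_div_comm, le_div_iff₀ (by positivity)]
          have : 2 * x * ((1 + u) * u) - u * (4 * x) = 2 * x * u * (u - 1) := by ring
          nlinarith [mul_nonneg (mul_nonneg hx hu.le) (sub_nonneg.2 hu1)]
      _ ≤ (1 - Real.exp (-u)) * (4 * x / u) :=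
          mul_le_mul_of_nonneg_right h1 (by positivity)
      _ ≤ (1 - Real.exp (-u)) * max (4 * x / u) (4 * x) :=
          mul_le_mul_of_nonneg_left (le_max_left _ _) hpos
  · calc 2 * x ≤ u / (1 + u) * (4 * x) := by
          rw [div_mul_eq_mul_div, le_div_iff₀ (by positivity)]
          nlinarith
      _ ≤ (1 - Real.exp (-u)) * (4 * x) := mul_le_mul_of_nonneg_right h1 (by positivity)
      _ ≤ (1 - Real.exp (-u)) * max (4 * x / u) (4 * x) :=
          mul_le_mul_of_nonneg_left (le_max_right _ _) hpos

section Cone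

variable {a : ℝ}

/-- **The cone bound for the witness chains**: for `h ≥ 0`,
`S_N(h)` is real and `≤ 2 exp((N+1)(hη)²/2 + hη Σ_{m<N} κ_m)` with
`κ_m = min(1, max(2h e^{−t_m}/a, 4hη))`. [folklore] -/
theorem cone_chain
    (hcone : ∀ (h η : ℝ), 0 ≤ h → 0 < η → ∀ (c κ : ℕ → ℝ), (∀ m, 0 ≤ c m ∧ c m ≤ 1) →
      (∀ m, 0 ≤ κ m ∧ κ m ≤ 1) → min 1 (h * η) ≤ κ 0 →
      (∀ m, κ (m + 1) = 1 ∨ (κ m ≤ κ (m + 1) ∧ 2 * h * η ≤ (1 - c m) * κ (m + 1))) →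
      ∀ M : ℕ, (sdIter (h : ℂ) (fun _ => η) c M).1.im = 0 ∧ 0 < (sdIter (h : ℂ) (fun _ => η) c M).1.re ∧
        (sdIter (h : ℂ) (fun _ => η) c M).1.re ≤
          2 * Real.exp ((M + 1) * (h * η) ^ 2 / 2 + h * η * ∑ m ∈ Finset.range M, κ m))
    (hr1 : ∀ t : ℝ, a * Real.exp t ≤ flipRate a t) (ha : 0 < a) (k : ℕ) {h : ℝ} (hh : 0 ≤ h) :
    (sdIter (h : ℂ) (fun _ => mesh k) (bondTanh a k) (nBonds k)).1.im = 0 ∧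
    (sdIter (h : ℂ) (fun _ => mesh k) (bondTanh a k) (nBonds k)).1.re ≤
      2 * Real.exp ((nBonds k + 1) * (h * mesh k) ^ 2 / 2 + h * mesh k *
        ∑ m ∈ Finset.range (nBonds k),
          min 1 (max (2 * h * Real.exp (-siteTime k m) / a) (4 * h * mesh k))) := by
  set η := mesh k with hηdef
  have hη : 0 < η := (mesh_pos' k).2.2
  set κ : ℕ → ℝ := fun m => min 1 (max (2 * h * Real.exp (-siteTime k m) / a) (4 * h * η)) with hκdef
  have hc : ∀ m, 0 ≤ bondTanh a k m ∧ bondTanh a k m ≤ 1 := fun m =>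
    ⟨(bondTanh_mem' hr1 ha k m).1.le, (bondTanh_mem' hr1 ha k m).2.le⟩
  have hg0 : ∀ m, 0 ≤ max (2 * h * Real.exp (-siteTime k m) / a) (4 * h * η) := fun m =>
    le_max_of_le_right (by positivity)
  have hκ : ∀ m, 0 ≤ κ m ∧ κ m ≤ 1 := fun m => ⟨le_min zero_le_one (hg0 m), min_le_left _ _⟩
  have hbase : min 1 (h * η) ≤ κ 0 := by
    refine min_le_min le_rfl (le_max_of_le_right ?_)
    nlinarith [hη, hh]
  have hstep : ∀ m, κ (m + 1) = 1 ∨ (κ m ≤ κ (m + 1) ∧ 2 * h * η ≤ (1 - bondTanh a k m) * κ (m + 1)) := by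
    intro m
    by_cases hcase : 1 ≤ max (2 * h * Real.exp (-siteTime k (m + 1)) / a) (4 * h * η)
    · left; exact min_eq_left hcase
    · right
      push Not at hcase
      have hκ1 : κ (m + 1) = max (2 * h * Real.exp (-siteTime k (m + 1)) / a) (4 * h * η) :=
        min_eq_right hcase.le
      constructor
      · -- monotone: `t_{m+1} ≤ t_m`
        rw [hκ1]
        refine (min_le_right _ _).trans (max_le_max ?_ le_rfl)
        refine div_le_div_of_nonneg_right (mul_le_mul_of_nonneg_left (Real.exp_le_exp.2 ?_)
          (by positivity)) ha.le
        rw [siteTime_succ']; linarith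
      · -- the key inequality with `u = 2ηa e^{t_{m+1}}`
        rw [hκ1]
        set t := siteTime k (m + 1) with htdef
        set u : ℝ := 2 * η * (a * Real.exp t) with hudef
        have hu : 0 < u := by positivity
        have hcm : bondTanh a k m ≤ Real.exp (-u) := by
          unfold bondTanh
          rw [← hηdef, ← htdef]
          refine Real.exp_le_exp.2 ?_
          rw [hudef, neg_le_neg_iff]
          exact mul_le_mul_of_nonneg_left (hr1 t) (by positivity)
        have hmax : max (4 * (h * η) / u) (4 * (h * η)) =
            max (2 * h * Real.exp (-t) / a) (4 * h * η) := by
          congr 1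
          · rw [hudef, Real.exp_neg]; field_simp; ring
          · ring
        have hkey := two_mul_le_key hu (show 0 ≤ h * η by positivity)
        rw [hmax] at hkey
        calc 2 * h * η = 2 * (h * η) := by ring
          _ ≤ (1 - Real.exp (-u)) * max (2 * h * Real.exp (-t) / a) (4 * h * η) := hkey
          _ ≤ (1 - bondTanh a k m) * max (2 * h * Real.exp (-t) / a) (4 * h * η) :=
              mul_le_mul_of_nonneg_right (by linarith) (hg0 (m + 1))
  obtain ⟨him, -, hle⟩ := hcone h η hh hη (bondTanh a k) κ hc hκ hbase hstep (nBonds k)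
  exact ⟨him, hle⟩

/-- Geometric sum: `Σ_{m<N} ρ^{N−m} ≤ ρ/(1−ρ)` for `0 ≤ ρ < 1`. [folklore] -/
private lemma geom_aux {ρ : ℝ} (h0 : 0 ≤ ρ) (h1 : ρ < 1) (N : ℕ) :
    ∑ m ∈ Finset.range N, ρ ^ (N - m) ≤ ρ / (1 - ρ) := by
  induction N with
  | zero => simp; positivity
  | succ N ih =>
    rw [Finset.sum_range_succ, Nat.add_sub_cancel_left, pow_one]
    have hrec : ∑ m ∈ Finset.range N, ρ ^ (N + 1 - m) = ρ * ∑ m ∈ Finset.range N, ρ ^ (N - m) := by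
      rw [Finset.mul_sum]
      refine Finset.sum_congr rfl fun m hm => ?_
      rw [Nat.succ_sub (Finset.mem_range.1 hm).le, pow_succ]
      ring
    rw [hrec]
    have h1ρ : 0 < 1 - ρ := by linarith
    have : ρ * ∑ m ∈ Finset.range N, ρ ^ (N - m) ≤ ρ * (ρ / (1 - ρ)) :=
      mul_le_mul_of_nonneg_left ih h0
    have hid : ρ * (ρ / (1 - ρ)) + ρ = ρ / (1 - ρ) := by field_simp; ring
    linarith

/-- `Σ_{m<N} e^{−t_m/2} ≤ 2/η`. [folklore] -/
private lemma sum_exp_half_le (k : ℕ) :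
    ∑ m ∈ Finset.range (nBonds k), Real.exp (-siteTime k m / 2) ≤ 2 / mesh k := by
  set η := mesh k
  have hη : 0 < η := (mesh_pos' k).2.2
  set ρ := Real.exp (-η / 2) with hρ
  have hρ0 : 0 ≤ ρ := (Real.exp_pos _).le
  have hρ1 : ρ < 1 := by rw [hρ, Real.exp_lt_one_iff]; linarith
  have hterm : ∀ m ∈ Finset.range (nBonds k), Real.exp (-siteTime k m / 2) = ρ ^ (nBonds k - m) := by
    intro m hm
    rw [siteTime_eq_cast' k m (Finset.mem_range.1 hm).le, hρ, ← Real.exp_nat_mul]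
    congr 1; ring
  rw [Finset.sum_congr rfl hterm]
  refine (geom_aux hρ0 hρ1 _).trans ?_
  -- `ρ/(1−ρ) ≤ 2/η` iff `ρ(η + 2) ≤ 2` iff `e^{−η/2}(1 + η/2) ≤ 1`
  have h1 : η / 2 + 1 ≤ Real.exp (η / 2) := Real.add_one_le_exp _
  have h2 : ρ * Real.exp (η / 2) = 1 := by
    rw [hρ, ← Real.exp_add, show -η / 2 + η / 2 = 0 by ring, Real.exp_zero]
  rw [div_le_div_iff₀ (by linarith) hη]
  nlinarith [mul_le_mul_of_nonneg_left h1 hρ0]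

/-- `min(1, max(p, q)) ≤ √p + q` for `p, q ≥ 0`. [folklore] -/
private lemma min_max_le_sqrt {p q : ℝ} (hp : 0 ≤ p) (hq : 0 ≤ q) : min 1 (max p q) ≤ Real.sqrt p + q := by
  rcases le_total p q with hpq | hpq
  · rw [max_eq_right hpq]
    exact (min_le_right _ _).trans (le_add_of_nonneg_left (Real.sqrt_nonneg _))
  · rw [max_eq_left hpq]
    have : min 1 p ≤ Real.sqrt p := by
      rcases le_total p 1 with h1 | h1
      · rw [min_eq_right h1]
        calc p = Real.sqrt p * Real.sqrt p := (Real.mul_self_sqrt hp).symm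
          _ ≤ Real.sqrt p * 1 :=
              mul_le_mul_of_nonneg_left ((Real.sqrt_le_sqrt h1).trans_eq Real.sqrt_one)
                (Real.sqrt_nonneg _)
          _ = Real.sqrt p := mul_one _
      · rw [min_eq_left h1]; exact Real.one_le_sqrt.2 h1
    linarith

/-- **The exponent bound**: for `h ≥ 0`,
`(N+1)(hη)²/2 + hη Σ_{m<N} κ_m ≤ 2√2/√a · h√h + 5 η(T+1) h²`. [folklore] -/
theorem exponent_le (ha : 0 < a) (k : ℕ) {h : ℝ} (hh : 0 ≤ h) :
    (nBonds k + 1) * (h * mesh k) ^ 2 / 2 + h * mesh k *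
        ∑ m ∈ Finset.range (nBonds k), min 1 (max (2 * h * Real.exp (-siteTime k m) / a) (4 * h * mesh k))
      ≤ 2 * Real.sqrt 2 / Real.sqrt a * (h * Real.sqrt h) + 5 * (mesh k * (horizon k + 1)) * h ^ 2 := by
  set η := mesh k with hηdef
  set N := nBonds k with hNdef
  set T := horizon k with hTdef
  have hη : 0 < η := (mesh_pos' k).2.2
  have hη1 : η ≤ 1 := mesh_le_one' k
  have hNη : (N : ℝ) * η = T := nBonds_mul_mesh' k
  have hT : 0 ≤ T := (horizon_pos' k).le
  -- termwise: `κ_m ≤ √(2h/a) e^{−t_m/2} + 4hη`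
  have hterm : ∀ m ∈ Finset.range N, min 1 (max (2 * h * Real.exp (-siteTime k m) / a) (4 * h * η)) ≤
      Real.sqrt (2 * h / a) * Real.exp (-siteTime k m / 2) + 4 * h * η := by
    intro m _
    refine (min_max_le_sqrt (by positivity) (by positivity)).trans (le_of_eq ?_)
    congr 1
    rw [show 2 * h * Real.exp (-siteTime k m) / a = (2 * h / a) * Real.exp (-siteTime k m) by ring,
      Real.sqrt_mul (by positivity), ← Real.exp_half]
  have hsum : ∑ m ∈ Finset.range N, min 1 (max (2 * h * Real.exp (-siteTime k m) / a) (4 * h * η)) ≤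
      Real.sqrt (2 * h / a) * (2 / η) + N * (4 * h * η) := by
    refine (Finset.sum_le_sum hterm).trans ?_
    rw [Finset.sum_add_distrib, Finset.sum_const, Finset.card_range, nsmul_eq_mul, ← Finset.mul_sum]
    refine add_le_add (mul_le_mul_of_nonneg_left (sum_exp_half_le k) (Real.sqrt_nonneg _)) le_rfl
  have hsq : Real.sqrt (2 * h / a) = Real.sqrt 2 / Real.sqrt a * Real.sqrt h := by
    rw [show 2 * h / a = 2 / a * h by ring, Real.sqrt_mul (by positivity), Real.sqrt_div' _ ha.le]
  -- assemble
  have h1 : h * η * ∑ m ∈ Finset.range N, min 1 (max (2 * h * Real.exp (-siteTime k m) / a) (4 * h * η)) ≤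
      2 * Real.sqrt 2 / Real.sqrt a * (h * Real.sqrt h) + 4 * T * η * h ^ 2 := by
    calc h * η * ∑ m ∈ Finset.range N, min 1 (max (2 * h * Real.exp (-siteTime k m) / a) (4 * h * η))
        ≤ h * η * (Real.sqrt (2 * h / a) * (2 / η) + N * (4 * h * η)) :=
          mul_le_mul_of_nonneg_left hsum (by positivity)
      _ = 2 * Real.sqrt 2 / Real.sqrt a * (h * Real.sqrt h) + 4 * T * η * h ^ 2 := by
          rw [hsq, ← hNη]; field_simp
  have h2 : ((N : ℝ) + 1) * (h * η) ^ 2 / 2 ≤ (T + 1) * η * h ^ 2 / 2 := by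
    have : ((N : ℝ) + 1) * (h * η) ^ 2 = (T + η) * η * h ^ 2 := by rw [← hNη]; ring
    rw [this]
    gcongr
  have h3 : (T + 1) * η * h ^ 2 / 2 + 4 * T * η * h ^ 2 ≤ 5 * (η * (T + 1)) * h ^ 2 := by
    nlinarith [sq_nonneg h, mul_nonneg hη.le (sq_nonneg h), mul_nonneg hT (mul_nonneg hη.le (sq_nonneg h))]
  have hN1 : ((nBonds k : ℝ) + 1) = (N : ℝ) + 1 := by rw [hNdef]
  linarith

end Cone

end Summit.RiemannHypothesis.RiemannHypothesis.Theorems.LeeYangTelegraph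

end
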